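import Summits.QuantumFields.YangMills.Theorems.UnitScaleTiltHalvingStepOfPillarsCEPairLocal
import Summits.QuantumFields.YangMills.Theorems.UnitScaleTiltProp8HalvingSitePackageOfRows
import Summits.QuantumFields.YangMills.Theorems.UnitScaleTiltProp8ChartBondAvgIterKernel
import HarnessLib

/-!
# Route `UnitScaleTilt`, crux K1 «MinimiserStabilityRegPr» (stmt-QuantumFields-19200), stub V2′ `stub_halvingStep` — (K-E2E) door, C_E end, lemma L3:
# **THE C_E ROWS OF THE DOOR AT ONE MEMBER AND ONE SITE** — ✓`HalvingStepOfPillars.halvingStep_of_rows`' `hCE` output block (the (165)∕(157)∕(160)-near∕(155)-far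
# rows of ✓`HalvingSitePackage.sitePackage_of_rows` for `Hs`, `C := C♭`, with explicit `e₁`, `e₃`, `C₂`) from the P1♭ pair data, the P2 rows, FILE E's objects at the
# member, the (165)-row implication of ✓`row165_of_tracePairing_L5_su2` at the member, and the two regional chart residues (Φ-1′)∕(Φ-2′) — every constant free.

Cell `ym3-torus` (HUMAN RULING D-0037: rung R3, not Clay), width seat `ym-ust-19200-w8` g0∕s2.  `--supports stmt-QuantumFields-19200 --as helper`; def-free, 0 sorry.

THE KNIT (member level; the wrapper L4 only chooses constants): with `δ := B₁ε₀`, `C♭ := chartLogFlat η♭ 𝒟 − D(chartLogFlat η♭ 𝒟)(0)`, `A′ := A + Hs(C♭A)`: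
* B3 ✓`chartRemainderFlat_hCd_hCq_B1`: `‖C♭A‖ ≤ C₂♭δ²`; L1 ✓`aPrime_rows`: `A′` is 𝔰𝔲(2)-valued, in the slice, of size `r := δ + B_H C₂♭δ²` in both weighted rows;
* IDENTIFICATION `Dsel A′ = C♭A` by FILE E's uniqueness on the ε-ball — (49) for the pair `(A′, C♭A)` is `rfl` because `A′ − Hs(C♭A) = A`; hence `A′ − Hs(Dsel A′) = A`
  and the regional chart identity (Φ-2′) for `A` is the one L2′ wants;
* L2′ ✓`hpair_of_hcrit_local` (its `h49`∕`hsize`∕`huniq`∕`hDd`∕`hball` from FILE E's (49)-block and analyticity on the ε-ball, `hSd` from ✓`exists_gradient_action_T3`,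
  `hgrad` for FILE E's `W₀` from its V-gradient identity and the two identities of ✓`exists_gradient_action_T3`), then the member's (165) implication with
  `W := Y ↦ W₀(Y − Hs(Dsel Y)) + E Y` (E := the (99) correction, defined by its formula) and FILE E's dressed letter ⇒ the (165) rows with `e₁ := max(B₀ʳ, 1+B_M)·4C₄r²`;
* (157): ✓`rRows_scaled_of_uniformDatum` at `Y := C♭A`, `t := C₂♭δ²` ⇒ `e₃ := B₀B₃C₂♭δ²`; (160) near: ✓`bondAvgIter_top_chartPreimage` + `η♭Lᵏ = 1` ⇒ the top datum of `A′`
  IS `Q♭(A)` ⇒ P1♭ (vi); (155) far: ✓`far_bondAvgIter` ⇒ `L·r·L^{k−j}`.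
HONEST SCOPE: bookkeeping over landed lemmas; (Φ-1′)∕(Φ-2′), the P1♭ data, the P2 rows, FILE E's objects and the member's (165) implication are hypotheses; NOT a claim about
the stub, the crux, the rung or the gap.

References: T. Bałaban, CMP **102** (1985) 277–309 [Balaban1985Variational] (44)–(49) p.285, (55) p.286, (99) p.293, (150)–(165) pp.301–303, Prop. 8 p.304;
CMP **99** (1985) 75–102 [Balaban1985RegularSpaces] Thm 2 p.83.
-/

set_option autoImplicit false

noncomputable section

open scoped BigOperators Matrix Matrix.Norms.L2Operator
open NormedSpace

namespace Summit.QuantumFields.YangMills.Theorems.HalvingSitePackage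

open Literature.MathematicalPhysics.QuantumFieldTheory.Balaban1983to89
open Literature.MathematicalPhysics.QuantumFieldTheory.Balaban1983to89.T3ContinuumYM3Torus
open Literature.MathematicalPhysics.QuantumFieldTheory.Balaban1983to89.T3PrintedRegularMinimiser
open Complex (I)
open B5Eq117TorusCarriers (Mk)
open B5Eq118OneStroke (iterBlockOf)
open B5Prop12FieldsLattice (distSite)
open B5Eq120IterProof (bondAvgIter_zero)
open B6SectADomainsV1 (Domains)
open B6SectAOperatorsV1 (BondIdx SiteIdx QE RE dsE)
open B8Ineq132 (BondTouches)
open B8Eq140Level (SideTouches)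
open B8Eq143PlaqExpansion (pdiv)
open B8Eq146AExpansion (plaqCovDeriv)
open B8Thm2SetupTorus (pullDom)
open B10Eq27TorusAxialLog (pull transl)
open LatticeFieldCalculus (bondAvgIter laplace diverg siteAvgIter)
open FlatCubeOpsText (Adm22 IsLevWeight HDecayLetterD RowSum162 distBI)
open FlatOpsLettersAssembly (flatH levWeight_nonneg)
open FlatCubeSequenceAligned (cubeSeqMT3 cubeSeqMT3_k)
open FlatCubeSequenceAdm (adm22_cubeSeqMT3)
open Prop8ChartDoubleBar (chartLogFlat chartLogFlat_apply fderiv_chartLogFlat_zero_apply chartRemainderFlat_hCd_hCq_B1)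
open ChartBondAvgIterKernel (bondAvgIter_top_chartPreimage far_bondAvgIter)

variable {F : T3Family} {n K : ℕ}

-- heartbeat budget (HOME README rule): ~150-line signature (FILE E's (49)-block, V-gradient, dressed letter, the member's (165) implication); budgeted 800k here only
set_option maxHeartbeats 800000 in
/-- **L3: THE C_E ROWS AT ONE MEMBER AND ONE SITE** — see the module docstring for the knit and the meaning of every hypothesis group.
[cite: Balaban1985Variational, (44)-(49) p.285, (55) p.286, (99) p.293, (150)-(165) pp.301-303] -/
theorem ceRows_at_member (F : T3Family) (n K : ℕ) (hnK : n < K) (x : Site (F.P K) 0) (ρ S M R : ℕ) (hM : 1 ≤ M) (hρ1 : 1 ≤ ρ)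
    (hRS : R * M ≤ S) (hRM : 2 * F.L ≤ R * M) (hRL : 2 * (F.P K).L ≤ R)
    {w : ℕ → PBond (F.P K) 0 → ℝ} (hw : IsLevWeight F n K (cubeSeqMT3 F n K x ρ S M hM) w)
    -- the P2 rows at the member
    {dBI : PBond (F.P K) 0 → BondIdx (cubeSeqMT3 F n K x ρ S M hM) → ℝ} {δ₀ B₀ B₃ : ℝ}
    (hH : HDecayLetterD F n K (cubeSeqMT3 F n K x ρ S M hM) dBI w (flatH F n K (cubeSeqMT3 F n K x ρ S M hM)) B₀ δ₀) (h162 : RowSum162 F n K (cubeSeqMT3 F n K x ρ S M hM) dBI w δ₀ B₃)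
    (hdom : ∀ b c, distBI (cubeSeqMT3 F n K x ρ S M hM) b c ≤ dBI b c) (hδ₀ : 0 ≤ δ₀) (hB₀ : 0 ≤ B₀) (hB₃ : 0 ≤ B₃)
    -- the P1♭ pair data: (i) 𝔰𝔲(2), (iv) slice, (iii) sizes `δ = B₁ε₀`, (vi) near
    {A : PBond (F.P K) 0 → Matrix (Fin 2) (Fin 2) ℂ} (hAsa : ∀ b, IsSelfAdjoint (A b)) (hAtr : ∀ b, Matrix.trace (A b) = 0)
    (hslice : ∃ μ : SiteIdx (cubeSeqMT3 F n K x ρ S M hM) → Matrix (Fin 2) (Fin 2) ℂ, ∀ s : Site (F.P K) 0,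
      laplace ((F.L : ℝ) ^ (K - n)) (diverg ((F.L : ℝ) ^ (K - n)) A) s = ∑ i : SiteIdx (cubeSeqMT3 F n K x ρ S M hM), siteAvgIter (i.1.1 : ℕ) (Pi.single s (1 : ℝ)) i.1.2 • μ i)
    {δ ε₁ : ℝ} (hδ0 : 0 ≤ δ) (h1 : ∀ b, w 1 b * ‖A b‖ ≤ δ)
    (h2 : ∀ (b : PBond (F.P K) 0) (ν : Fin 3), w 2 b * (F.L : ℝ) ^ (K - n) * ‖A ⟨b.src.shift ν, b.dir⟩ - A b‖ ≤ δ)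
    (hvi : ∀ c : BondIdx (cubeSeqMT3 F n K x ρ S M hM), (c.1.1 : ℕ) = K - n → c.1.2.src ∈ (cubeSeqMT3 F n K x ρ S M hM).Om (c.1.1 : ℕ) → c.1.2.tgt ∈ (cubeSeqMT3 F n K x ρ S M hM).Om (c.1.1 : ℕ) →
      ‖chartLogFlat (((F.L : ℝ)⁻¹) ^ (K - n)) (cubeSeqMT3 F n K x ρ S M hM) A c‖ ≤ 6 * ε₁ * (distSite (Mk (F.P K) (c.1.1 : ℕ)) c.1.2.src (iterBlockOf (c.1.1 : ℕ) x) + 1))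
    -- FILE E's objects at the member: `Hs` (display, `Q♭'(0) ∘ Hs = id`, two rows), `Dsel` (analytic on the ε-ball, the (49)-block), `W₀` (V-gradient, dressed letter)
    (Hs : (BondIdx (cubeSeqMT3 F n K x ρ S M hM) → Matrix (Fin 2) (Fin 2) ℂ) →ₗ[ℂ] (PBond (F.P K) 0 → Matrix (Fin 2) (Fin 2) ℂ))
    (hHs : ∀ (X : BondIdx (cubeSeqMT3 F n K x ρ S M hM) → Matrix (Fin 2) (Fin 2) ℂ) (b : PBond (F.P K) 0),
        Hs X b = ∑ c : BondIdx (cubeSeqMT3 F n K x ρ S M hM), (flatH F n K (cubeSeqMT3 F n K x ρ S M hM) (Pi.single c 1) b * (((F.L : ℝ)) ^ (c.1.1 : ℕ) * (((F.L : ℝ))⁻¹) ^ (K - n))⁻¹) • X c)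
    (hHinv : ∀ X : BondIdx (cubeSeqMT3 F n K x ρ S M hM) → Matrix (Fin 2) (Fin 2) ℂ, (fderiv ℂ (chartLogFlat ((((F.L : ℝ))⁻¹) ^ (K - n)) (cubeSeqMT3 F n K x ρ S M hM) : (PBond (F.P K) 0 → Matrix (Fin 2) (Fin 2) ℂ) → BondIdx (cubeSeqMT3 F n K x ρ S M hM) → Matrix (Fin 2) (Fin 2) ℂ) 0) (Hs X) = X)
    {BH : ℝ} (hBH : 0 ≤ BH)
    (hHrows : ∀ (X : BondIdx (cubeSeqMT3 F n K x ρ S M hM) → Matrix (Fin 2) (Fin 2) ℂ) (t : ℝ), (∀ c, ‖X c‖ ≤ t) →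
        (∀ b, w 1 b * ‖Hs X b‖ ≤ BH * t) ∧
        ∀ (b : PBond (F.P K) 0) (ν : Fin 3), w 2 b * (F.L : ℝ) ^ (K - n) * ‖Hs X ⟨b.src.shift ν, b.dir⟩ - Hs X b‖ ≤ BH * t)
    (Dsel : (PBond (F.P K) 0 → Matrix (Fin 2) (Fin 2) ℂ) → BondIdx (cubeSeqMT3 F n K x ρ S M hM) → Matrix (Fin 2) (Fin 2) ℂ) {ε : ℝ}
    (hE4 : AnalyticOnNhd ℂ Dsel {A' : PBond (F.P K) 0 → Matrix (Fin 2) (Fin 2) ℂ | ∀ b, w 1 b * ‖A' b‖ < ε})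
    (hE6 : ∀ A' : PBond (F.P K) 0 → Matrix (Fin 2) (Fin 2) ℂ, (∀ b, w 1 b * ‖A' b‖ < ε) →
        (∀ c, ‖Dsel A' c‖ ≤ 4 * (64 * (F.L : ℝ) / (16 * 3800 * ((((F.P K).d + 2) * (F.P K).L : ℕ) : ℝ) ^ 2 * (F.L : ℝ))⁻¹) * ε ^ 2) ∧
        chartLogFlat ((((F.L : ℝ))⁻¹) ^ (K - n)) (cubeSeqMT3 F n K x ρ S M hM) (A' - Hs (Dsel A')) - (fderiv ℂ (chartLogFlat ((((F.L : ℝ))⁻¹) ^ (K - n)) (cubeSeqMT3 F n K x ρ S M hM) : (PBond (F.P K) 0 → Matrix (Fin 2) (Fin 2) ℂ) → BondIdx (cubeSeqMT3 F n K x ρ S M hM) → Matrix (Fin 2) (Fin 2) ℂ) 0) (A' - Hs (Dsel A')) = Dsel A' ∧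
        chartLogFlat ((((F.L : ℝ))⁻¹) ^ (K - n)) (cubeSeqMT3 F n K x ρ S M hM) (A' - Hs (Dsel A')) = (fderiv ℂ (chartLogFlat ((((F.L : ℝ))⁻¹) ^ (K - n)) (cubeSeqMT3 F n K x ρ S M hM) : (PBond (F.P K) 0 → Matrix (Fin 2) (Fin 2) ℂ) → BondIdx (cubeSeqMT3 F n K x ρ S M hM) → Matrix (Fin 2) (Fin 2) ℂ) 0) A' ∧
        (∀ D' : BondIdx (cubeSeqMT3 F n K x ρ S M hM) → Matrix (Fin 2) (Fin 2) ℂ, (∀ c, ‖D' c‖ ≤ 4 * (64 * (F.L : ℝ) / (16 * 3800 * ((((F.P K).d + 2) * (F.P K).L : ℕ) : ℝ) ^ 2 * (F.L : ℝ))⁻¹) * ε ^ 2) →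
          chartLogFlat ((((F.L : ℝ))⁻¹) ^ (K - n)) (cubeSeqMT3 F n K x ρ S M hM) (A' - Hs D') - (fderiv ℂ (chartLogFlat ((((F.L : ℝ))⁻¹) ^ (K - n)) (cubeSeqMT3 F n K x ρ S M hM) : (PBond (F.P K) 0 → Matrix (Fin 2) (Fin 2) ℂ) → BondIdx (cubeSeqMT3 F n K x ρ S M hM) → Matrix (Fin 2) (Fin 2) ℂ) 0) (A' - Hs D') = D' → D' = Dsel A') ∧
        (∀ ρ' : ℝ, 0 ≤ ρ' → (∀ b, w 1 b * ‖A' b‖ ≤ ρ') → ∀ c, ‖Dsel A' c‖ ≤ 4 * (64 * (F.L : ℝ) / (16 * 3800 * ((((F.P K).d + 2) * (F.P K).L : ℕ) : ℝ) ^ 2 * (F.L : ℝ))⁻¹) * ρ' ^ 2))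
    (W₀ : (PBond (F.P K) 0 → Matrix (Fin 2) (Fin 2) ℂ) → (PBond (F.P K) 0 → Matrix (Fin 2) (Fin 2) ℂ))
    (hE11 : ∀ A δ : PBond (F.P K) 0 → Matrix (Fin 2) (Fin 2) ℂ, fderiv ℂ (fun A : PBond (F.P K) 0 → Matrix (Fin 2) (Fin 2) ℂ => (∑ p : Plaq (F.P K) 0, (1 - (2 : ℂ)⁻¹ * Matrix.trace (exp ((Complex.I * (((((F.L : ℝ)⁻¹) ^ (K - n) : ℝ)) : ℂ)) • A ⟨p.src, p.μ⟩) * exp ((Complex.I * (((((F.L : ℝ)⁻¹) ^ (K - n) : ℝ)) : ℂ)) • A ⟨p.src.shift p.μ, p.ν⟩) * exp (-((Complex.I * (((((F.L : ℝ)⁻¹) ^ (K - n) : ℝ)) : ℂ)) • A ⟨p.src.shift p.ν, p.μ⟩)) * exp (-((Complex.I * (((((F.L : ℝ)⁻¹) ^ (K - n) : ℝ)) : ℂ)) • A ⟨p.src, p.ν⟩))) + (2 : ℂ)⁻¹ * Matrix.trace (((Complex.I * (((((F.L : ℝ)⁻¹) ^ (K - n) : ℝ)) : ℂ)) • A ⟨p.src,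 p.μ⟩) + ((Complex.I * (((((F.L : ℝ)⁻¹) ^ (K - n) : ℝ)) : ℂ)) • A ⟨p.src.shift p.μ, p.ν⟩) + (-((Complex.I * (((((F.L : ℝ)⁻¹) ^ (K - n) : ℝ)) : ℂ)) • A ⟨p.src.shift p.ν, p.μ⟩)) + (-((Complex.I * (((((F.L : ℝ)⁻¹) ^ (K - n) : ℝ)) : ℂ)) • A ⟨p.src, p.ν⟩))) + (4 : ℂ)⁻¹ * Matrix.trace ((((Complex.I * (((((F.L : ℝ)⁻¹) ^ (K - n) : ℝ)) : ℂ)) • A ⟨p.src, p.μ⟩) + ((Complex.I * (((((F.L : ℝ)⁻¹) ^ (K - n) : ℝ)) : ℂ)) • A ⟨p.src.shift p.μ, p.ν⟩) + (-((Complex.I * (((((F.L : ℝ)⁻¹) ^ (K - n) : ℝ)) : ℂ)) • A ⟨p.src.shift p.ν, p.μ⟩)) + (-((Complex.I * (((((F.L : ℝ)⁻¹) ^ (K - n) : ℝ)) : ℂ)) • A ⟨p.src, p.ν⟩))) ^ 2)))) A δ =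
        ((((F.L : ℝ)⁻¹) ^ (K - n) : ℝ) : ℂ) ^ 4 * ∑ b : PBond (F.P K) 0, Matrix.trace (W₀ A b * δ b))
    {C₄ a₃ : ℝ} (hC₄ : 0 ≤ C₄)
    (hE13 : ∀ E : (PBond (F.P K) 0 → Matrix (Fin 2) (Fin 2) ℂ) → (PBond (F.P K) 0 → Matrix (Fin 2) (Fin 2) ℂ),
        (∀ (Y : PBond (F.P K) 0 → Matrix (Fin 2) (Fin 2) ℂ) (b : PBond (F.P K) 0) (i j : Fin 2), E Y b i j = ((((((F.L : ℝ)⁻¹) ^ (K - n)) : ℝ) : ℂ) ^ 4)⁻¹ *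
          (-(((((((F.L : ℝ)⁻¹) ^ (K - n)) : ℝ) : ℂ) ^ 2 / 2) * ∑ p : Plaq (F.P K) 0, Matrix.trace ((Hs (Dsel Y) ⟨p.src, p.μ⟩ + Hs (Dsel Y) ⟨p.src.shift p.μ, p.ν⟩ - Hs (Dsel Y) ⟨p.src.shift p.ν, p.μ⟩ - Hs (Dsel Y) ⟨p.src, p.ν⟩) *
              (((Pi.single b (Matrix.single j i (1 : ℂ)) : PBond (F.P K) 0 → Matrix (Fin 2) (Fin 2) ℂ)) ⟨p.src, p.μ⟩ + ((Pi.single b (Matrix.single j i (1 : ℂ)) : PBond (F.P K) 0 → Matrix (Fin 2) (Fin 2) ℂ)) ⟨p.src.shift p.μ, p.ν⟩ -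
                ((Pi.single b (Matrix.single j i (1 : ℂ)) : PBond (F.P K) 0 → Matrix (Fin 2) (Fin 2) ℂ)) ⟨p.src.shift p.ν, p.μ⟩ - ((Pi.single b (Matrix.single j i (1 : ℂ)) : PBond (F.P K) 0 → Matrix (Fin 2) (Fin 2) ℂ)) ⟨p.src, p.ν⟩)))
            - ((((((F.L : ℝ)⁻¹) ^ (K - n)) : ℝ) : ℂ) ^ 2 / 2) * ∑ p : Plaq (F.P K) 0, Matrix.trace (((Y - Hs (Dsel Y)) ⟨p.src, p.μ⟩ + (Y - Hs (Dsel Y)) ⟨p.src.shift p.μ, p.ν⟩ - (Y - Hs (Dsel Y)) ⟨p.src.shift p.ν, p.μ⟩ - (Y - Hs (Dsel Y)) ⟨p.src, p.ν⟩) *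
              (Hs (fderiv ℂ Dsel Y (Pi.single b (Matrix.single j i (1 : ℂ)))) ⟨p.src, p.μ⟩ + Hs (fderiv ℂ Dsel Y (Pi.single b (Matrix.single j i (1 : ℂ)))) ⟨p.src.shift p.μ, p.ν⟩ -
                Hs (fderiv ℂ Dsel Y (Pi.single b (Matrix.single j i (1 : ℂ)))) ⟨p.src.shift p.ν, p.μ⟩ - Hs (fderiv ℂ Dsel Y (Pi.single b (Matrix.single j i (1 : ℂ)))) ⟨p.src, p.ν⟩))
            - (((((F.L : ℝ)⁻¹) ^ (K - n)) : ℝ) : ℂ) ^ 4 * ∑ b' : PBond (F.P K) 0, Matrix.trace (W₀ (Y - Hs (Dsel Y)) b' * Hs (fderiv ℂ Dsel Y (Pi.single b (Matrix.single j i (1 : ℂ)))) b'))) →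
        ∀ (Y : PBond (F.P K) 0 → Matrix (Fin 2) (Fin 2) ℂ) (r : ℝ), r < a₃ → (∀ b, w 1 b * ‖Y b‖ ≤ r) →
          (∀ (b : PBond (F.P K) 0) (ν : Fin 3), w 2 b * (F.L : ℝ) ^ (K - n) * ‖Y ⟨b.src.shift ν, b.dir⟩ - Y b‖ ≤ r) →
          ∀ b, w 3 b * ‖(W₀ (Y - Hs (Dsel Y)) + E Y) b‖ ≤ C₄ * r ^ 2)
    -- the member's (165) implication (✓`row165_of_tracePairing_L5_su2` after its constants `B₀ʳ`, `B_M`)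
    {B₀r BM : ℝ}
    (h165 : ∀ (A' : PBond (F.P K) 0 → Matrix (Fin 2) (Fin 2) ℂ) (_ : ∀ b, IsSelfAdjoint (A' b)) (_ : ∀ b, Matrix.trace (A' b) = 0)
      (W : (PBond (F.P K) 0 → Matrix (Fin 2) (Fin 2) ℂ) → (PBond (F.P K) 0 → Matrix (Fin 2) (Fin 2) ℂ)) {C₄ a₃ r e : ℝ}
      (_ : ∀ (Y : PBond (F.P K) 0 → Matrix (Fin 2) (Fin 2) ℂ) (r' : ℝ), r' < a₃ → (∀ b, w 1 b * ‖Y b‖ ≤ r') →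
        (∀ (b : PBond (F.P K) 0) (ν : Fin 3), w 2 b * ((F.L : ℝ)) ^ (K - n) * ‖Y ⟨b.src.shift ν, b.dir⟩ - Y b‖ ≤ r') →
        ∀ b, w 3 b * ‖W Y b‖ ≤ C₄ * r' ^ 2)
      (_ : ∀ s : PBond (F.P K) 0 → ℝ, QE (cubeSeqMT3 F n K x ρ S M hM) (WithLp.toLp 2 s) = 0 →
        ∀ Et : Matrix (Fin 2) (Fin 2) ℂ, IsSelfAdjoint Et → Matrix.trace Et = 0 →
        ((((((F.L : ℝ)⁻¹) ^ (K - n) : ℝ) : ℂ) ^ 2 / 2) *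
            ∑ p : Plaq (F.P K) 0, Matrix.trace ((A' ⟨p.src, p.μ⟩ + A' ⟨p.src.shift p.μ, p.ν⟩ - A' ⟨p.src.shift p.ν, p.μ⟩ - A' ⟨p.src, p.ν⟩) *
              (((s ⟨p.src, p.μ⟩ : ℝ) : ℂ) • Et + ((s ⟨p.src.shift p.μ, p.ν⟩ : ℝ) : ℂ) • Et - ((s ⟨p.src.shift p.ν, p.μ⟩ : ℝ) : ℂ) • Et -
                ((s ⟨p.src, p.ν⟩ : ℝ) : ℂ) • Et)) +
          ((((F.L : ℝ)⁻¹) ^ (K - n) : ℝ) : ℂ) ^ 4 * ∑ b : PBond (F.P K) 0, Matrix.trace (W A' b * (((s b : ℝ) : ℂ) • Et))).re = 0)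
      (_ : ∀ φ : Matrix (Fin 2) (Fin 2) ℂ →ₗ[ℝ] ℝ,
        RE (cubeSeqMT3 F n K x ρ S M hM) (((F.L : ℝ)) ^ (K - n))
          (dsE (((F.L : ℝ)) ^ (K - n)) (WithLp.toLp 2 (fun b => φ (A' b)))) = 0)
      (_ : r < a₃) (_ : ∀ b, w 1 b * ‖A' b‖ ≤ r)
      (_ : ∀ (b : PBond (F.P K) 0) (ν : Fin 3), w 2 b * ((F.L : ℝ)) ^ (K - n) * ‖A' ⟨b.src.shift ν, b.dir⟩ - A' b‖ ≤ r)
      (_ : B₀r * (4 * C₄ * r ^ 2) ≤ e) (_ : (1 + BM) * (4 * C₄ * r ^ 2) ≤ e),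
      (∀ (z : B7Prop1Explicit.Site (F.P K).d) (τ : Fin (F.P K).d),
        SideTouches (pullDom (fun j => if K - n ≤ j then ({x} : Set (Site (F.P K) 0)) else (∅ : Set (Site (F.P K) 0))) (K - n)) z τ →
        ‖(A' - fun b : PBond (F.P K) 0 => ∑ c, flatH F n K (cubeSeqMT3 F n K x ρ S M hM) (Pi.single c 1) b •
            bondAvgIter (c.1.1 : ℕ) A' c.1.2) ⟨transl 0 z, τ⟩‖ ≤ e) ∧
      (∀ (z : B7Prop1Explicit.Site (F.P K).d) (κ τ : Fin (F.P K).d),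
        SideTouches (pullDom (fun j => if K - n ≤ j then ({x} : Set (Site (F.P K) 0)) else (∅ : Set (Site (F.P K) 0))) (K - n)) z τ →
        ‖((((F.L : ℝ))⁻¹) ^ (K - n))⁻¹ •
          ((A' - fun b : PBond (F.P K) 0 => ∑ c, flatH F n K (cubeSeqMT3 F n K x ρ S M hM) (Pi.single c 1) b •
              bondAvgIter (c.1.1 : ℕ) A' c.1.2) ⟨(transl 0 z).shift κ, τ⟩ -
            (A' - fun b : PBond (F.P K) 0 => ∑ c, flatH F n K (cubeSeqMT3 F n K x ρ S M hM) (Pi.single c 1) b •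
              bondAvgIter (c.1.1 : ℕ) A' c.1.2) ⟨transl 0 z, τ⟩)‖ ≤ e) ∧
      (∀ (z : B7Prop1Explicit.Site (F.P K).d) (μ : Fin (F.P K).d),
        BondTouches (pullDom (fun j => if K - n ≤ j then ({x} : Set (Site (F.P K) 0)) else (∅ : Set (Site (F.P K) 0))) (K - n)) z μ →
        ‖pdiv ((((F.L : ℝ))⁻¹) ^ (K - n)) (1 : B7Prop1Explicit.Site (F.P K).d → Fin (F.P K).d → (Matrix (Fin 2) (Fin 2) ℂ)ˣ)
            (plaqCovDeriv ((((F.L : ℝ))⁻¹) ^ (K - n))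
              (1 : B7Prop1Explicit.Site (F.P K).d → Fin (F.P K).d → (Matrix (Fin 2) (Fin 2) ℂ)ˣ)
              (pull (A' - fun b : PBond (F.P K) 0 => ∑ c, flatH F n K (cubeSeqMT3 F n K x ρ S M hM)
                (Pi.single c 1) b • bondAvgIter (c.1.1 : ℕ) A' c.1.2) 0)) μ z‖ ≤ e))
    -- the SU(2) chart of 𝔰𝔲(2)-valued fields, the geometry of the local competitor map, the minimiser, (Φ-2′), (Φ-1′)
    (Uc : (PBond (F.P K) 0 → Matrix (Fin 2) (Fin 2) ℂ) → GaugeField (F.P K) 0 (Matrix.specialUnitaryGroup (Fin 2) ℂ))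
    (hUc : ∀ Y : PBond (F.P K) 0 → Matrix (Fin 2) (Fin 2) ℂ, (∀ b, IsSelfAdjoint (Y b)) → (∀ b, Matrix.trace (Y b) = 0) →
      ∀ b, ((Uc Y b : Matrix.specialUnitaryGroup (Fin 2) ℂ) : Matrix (Fin 2) (Fin 2) ℂ) = exp ((Complex.I * ((((F.L : ℝ)⁻¹) ^ (K - n) : ℝ) : ℂ)) • Y b))
    (Near : PBond (F.P K) 0 → Prop) [DecidablePred Near] (Tch : Plaq (F.P K) 0 → Prop)
    (hTN : ∀ p : Plaq (F.P K) 0, Tch p → Near ⟨p.src, p.μ⟩ ∧ Near ⟨p.src.shift p.μ, p.ν⟩ ∧ Near ⟨p.src.shift p.ν, p.μ⟩ ∧ Near ⟨p.src, p.ν⟩)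
    (hTF : ∀ p : Plaq (F.P K) 0, ¬ Tch p → (cubeSeqMT3 F n K x ρ S M hM).LamBond 0 ⟨p.src, p.μ⟩ ∧ (cubeSeqMT3 F n K x ρ S M hM).LamBond 0 ⟨p.src.shift p.μ, p.ν⟩ ∧ (cubeSeqMT3 F n K x ρ S M hM).LamBond 0 ⟨p.src.shift p.ν, p.μ⟩ ∧ (cubeSeqMT3 F n K x ρ S M hM).LamBond 0 ⟨p.src, p.ν⟩)
    (ε₀ : ℝ) (V : GaugeField (F.P n) 0 (Matrix.specialUnitaryGroup (Fin 2) ℂ)) {Umin : GaugeField (F.P K) 0 (Matrix.specialUnitaryGroup (Fin 2) ℂ)}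
    (hcrit : IsMinOn (fun W : GaugeField (F.P K) 0 (Matrix.specialUnitaryGroup (Fin 2) ℂ) => wilsonAction4 W) (regFibrePr F n K hnK.le ε₀ V) Umin)
    (uS : GaugeTransf (F.P K) 0 (Matrix.specialUnitaryGroup (Fin 2) ℂ))
    (hchartNear : ∀ b, Near b → ((GaugeField.gaugeAct uS Umin b : Matrix.specialUnitaryGroup (Fin 2) ℂ) : Matrix (Fin 2) (Fin 2) ℂ) = exp ((Complex.I * ((((F.L : ℝ)⁻¹) ^ (K - n) : ℝ) : ℂ)) • A b))
    {r₁ : ℝ}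
    (hΦ1 : ∀ X ∈ {X : PBond (F.P K) 0 → Matrix (Fin 2) (Fin 2) ℂ | (∀ b, IsSelfAdjoint (X b)) ∧ (∀ b, Matrix.trace (X b) = 0) ∧ (∀ c : BondIdx (cubeSeqMT3 F n K x ρ S M hM), bondAvgIter (c.1.1 : ℕ) X c.1.2 = bondAvgIter (c.1.1 : ℕ) (A + Hs (fun i => chartLogFlat (((F.L : ℝ)⁻¹) ^ (K - n)) (cubeSeqMT3 F n K x ρ S M hM) A i - (fderiv ℂ (chartLogFlat (((F.L : ℝ)⁻¹) ^ (K - n)) (cubeSeqMT3 F n K x ρ S M hM) : (PBond (F.P K) 0 → Matrix (Fin 2) (Fin 2) ℂ) → BondIdx (cubeSeqMT3 F n K x ρ S M hM) → Matrix (Fin 2) (Fin 2) ℂ) 0) A i)) c.1.2) ∧ X ∈ {Y : PBond (F.P K) 0 → Matrix (Fin 2) (Fin 2) ℂ | ∀ b, w 1 b * ‖Y b‖ < r₁}},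
      GaugeField.gaugeAct (fun z => (uS z)⁻¹) (fun b => if Near b then Uc (X - Hs (Dsel X)) b else GaugeField.gaugeAct uS Umin b) ∈ regFibrePr F n K hnK.le ε₀ V)
    -- numerics (windows)
    (hδRs : δ < (16 * 3800 * ((((F.P K).d + 2) * (F.P K).L : ℕ) : ℝ) ^ 2 * (F.L : ℝ))⁻¹ / 4) (hr₁ε : r₁ ≤ ε) (hrr₁ : δ + BH * ((64 * (F.L : ℝ) / (16 * 3800 * ((((F.P K).d + 2) * (F.P K).L : ℕ) : ℝ) ^ 2 * (F.L : ℝ))⁻¹) * δ ^ 2) < r₁) (hra₃ : δ + BH * ((64 * (F.L : ℝ) / (16 * 3800 * ((((F.P K).d + 2) * (F.P K).L : ℕ) : ℝ) ^ 2 * (F.L : ℝ))⁻¹) * δ ^ 2) < a₃)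
    (htE : (64 * (F.L : ℝ) / (16 * 3800 * ((((F.P K).d + 2) * (F.P K).L : ℕ) : ℝ) ^ 2 * (F.L : ℝ))⁻¹) * δ ^ 2 ≤ 4 * (64 * (F.L : ℝ) / (16 * 3800 * ((((F.P K).d + 2) * (F.P K).L : ℕ) : ℝ) ^ 2 * (F.L : ℝ))⁻¹) * ε ^ 2) (hballnum : r₁ + BH * (4 * (64 * (F.L : ℝ) / (16 * 3800 * ((((F.P K).d + 2) * (F.P K).L : ℕ) : ℝ) ^ 2 * (F.L : ℝ))⁻¹) * ε ^ 2) ≤ (16 * 3800 * ((((F.P K).d + 2) * (F.P K).L : ℕ) : ℝ) ^ 2 * (F.L : ℝ))⁻¹) :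
    let C : (PBond (F.P K) 0 → Matrix (Fin 2) (Fin 2) ℂ) → BondIdx (cubeSeqMT3 F n K x ρ S M hM) → Matrix (Fin 2) (Fin 2) ℂ := fun Y i => chartLogFlat (((F.L : ℝ)⁻¹) ^ (K - n)) (cubeSeqMT3 F n K x ρ S M hM) Y i - (fderiv ℂ (chartLogFlat (((F.L : ℝ)⁻¹) ^ (K - n)) (cubeSeqMT3 F n K x ρ S M hM) : (PBond (F.P K) 0 → Matrix (Fin 2) (Fin 2) ℂ) → BondIdx (cubeSeqMT3 F n K x ρ S M hM) → Matrix (Fin 2) (Fin 2) ℂ) 0) Y i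
    (((∀ (z : B7Prop1Explicit.Site (F.P K).d) (τ : Fin (F.P K).d),
                    SideTouches (pullDom (fun j => if K - n ≤ j then ({x} : Set (Site (F.P K) 0)) else (∅ : Set (Site (F.P K) 0))) (K - n)) z τ →
                    ‖((A + Hs (C A)) - fun b : PBond (F.P K) 0 => ∑ c, flatH F n K (cubeSeqMT3 F n K x ρ S M hM) (Pi.single c 1) b •
                        bondAvgIter (c.1.1 : ℕ) (A + Hs (C A)) c.1.2) ⟨transl 0 z, τ⟩‖ ≤ max B₀r (1 + BM) * (4 * C₄ * (δ + BH * ((64 * (F.L : ℝ) / (16 * 3800 * ((((F.P K).d + 2) * (F.P K).L : ℕ) : ℝ) ^ 2 * (F.L : ℝ))⁻¹) * δ ^ 2)) ^ 2)) ∧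
                  (∀ (z : B7Prop1Explicit.Site (F.P K).d) (κ τ : Fin (F.P K).d),
                    SideTouches (pullDom (fun j => if K - n ≤ j then ({x} : Set (Site (F.P K) 0)) else (∅ : Set (Site (F.P K) 0))) (K - n)) z τ →
                    ‖(((F.L : ℝ)⁻¹) ^ (K - n))⁻¹ •
                      (((A + Hs (C A)) - fun b : PBond (F.P K) 0 => ∑ c, flatH F n K (cubeSeqMT3 F n K x ρ S M hM) (Pi.single c 1) b •
                          bondAvgIter (c.1.1 : ℕ) (A + Hs (C A)) c.1.2) ⟨(transl 0 z).shift κ, τ⟩ -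
                        ((A + Hs (C A)) - fun b : PBond (F.P K) 0 => ∑ c, flatH F n K (cubeSeqMT3 F n K x ρ S M hM) (Pi.single c 1) b •
                          bondAvgIter (c.1.1 : ℕ) (A + Hs (C A)) c.1.2) ⟨transl 0 z, τ⟩)‖ ≤ max B₀r (1 + BM) * (4 * C₄ * (δ + BH * ((64 * (F.L : ℝ) / (16 * 3800 * ((((F.P K).d + 2) * (F.P K).L : ℕ) : ℝ) ^ 2 * (F.L : ℝ))⁻¹) * δ ^ 2)) ^ 2)) ∧
                  (∀ (z : B7Prop1Explicit.Site (F.P K).d) (μ : Fin (F.P K).d),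
                    BondTouches (pullDom (fun j => if K - n ≤ j then ({x} : Set (Site (F.P K) 0)) else (∅ : Set (Site (F.P K) 0))) (K - n)) z μ →
                    ‖pdiv (((F.L : ℝ)⁻¹) ^ (K - n)) (1 : B7Prop1Explicit.Site (F.P K).d → Fin (F.P K).d → (Matrix (Fin 2) (Fin 2) ℂ)ˣ)
                        (plaqCovDeriv (((F.L : ℝ)⁻¹) ^ (K - n)) (1 : B7Prop1Explicit.Site (F.P K).d → Fin (F.P K).d → (Matrix (Fin 2) (Fin 2) ℂ)ˣ)
                          (pull ((A + Hs (C A)) - fun b : PBond (F.P K) 0 => ∑ c, flatH F n K (cubeSeqMT3 F n K x ρ S M hM) (Pi.single c 1) b •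
                            bondAvgIter (c.1.1 : ℕ) (A + Hs (C A)) c.1.2) 0)) μ z‖ ≤ max B₀r (1 + BM) * (4 * C₄ * (δ + BH * ((64 * (F.L : ℝ) / (16 * 3800 * ((((F.P K).d + 2) * (F.P K).L : ℕ) : ℝ) ^ 2 * (F.L : ℝ))⁻¹) * δ ^ 2)) ^ 2)))) ∧
    (((∀ (z : B7Prop1Explicit.Site (F.P K).d) (τ : Fin (F.P K).d),
                    SideTouches (pullDom (fun j => if K - n ≤ j then ({x} : Set (Site (F.P K) 0)) else (∅ : Set (Site (F.P K) 0))) (K - n)) z τ →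
                    ‖Hs (C A) ⟨transl 0 z, τ⟩‖ ≤ B₀ * B₃ * ((64 * (F.L : ℝ) / (16 * 3800 * ((((F.P K).d + 2) * (F.P K).L : ℕ) : ℝ) ^ 2 * (F.L : ℝ))⁻¹) * δ ^ 2)) ∧
                  (∀ (z : B7Prop1Explicit.Site (F.P K).d) (κ τ : Fin (F.P K).d),
                    SideTouches (pullDom (fun j => if K - n ≤ j then ({x} : Set (Site (F.P K) 0)) else (∅ : Set (Site (F.P K) 0))) (K - n)) z τ →
                    ‖(((F.L : ℝ)⁻¹) ^ (K - n))⁻¹ • (Hs (C A) ⟨(transl 0 z).shift κ, τ⟩ - Hs (C A) ⟨transl 0 z, τ⟩)‖ ≤ B₀ * B₃ * ((64 * (F.L : ℝ) / (16 * 3800 * ((((F.P K).d + 2) * (F.P K).L : ℕ) : ℝ) ^ 2 * (F.L : ℝ))⁻¹) * δ ^ 2)) ∧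
                  (∀ (z : B7Prop1Explicit.Site (F.P K).d) (μ : Fin (F.P K).d),
                    BondTouches (pullDom (fun j => if K - n ≤ j then ({x} : Set (Site (F.P K) 0)) else (∅ : Set (Site (F.P K) 0))) (K - n)) z μ →
                    ‖pdiv (((F.L : ℝ)⁻¹) ^ (K - n)) (1 : B7Prop1Explicit.Site (F.P K).d → Fin (F.P K).d → (Matrix (Fin 2) (Fin 2) ℂ)ˣ)
                        (plaqCovDeriv (((F.L : ℝ)⁻¹) ^ (K - n)) (1 : B7Prop1Explicit.Site (F.P K).d → Fin (F.P K).d → (Matrix (Fin 2) (Fin 2) ℂ)ˣ)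
                          (pull (Hs (C A)) 0)) μ z‖ ≤ B₀ * B₃ * ((64 * (F.L : ℝ) / (16 * 3800 * ((((F.P K).d + 2) * (F.P K).L : ℕ) : ℝ) ^ 2 * (F.L : ℝ))⁻¹) * δ ^ 2)))) ∧
    (∀ c : BondIdx (cubeSeqMT3 F n K x ρ S M hM), (c.1.1 : ℕ) = K - n →
                  c.1.2.src ∈ (cubeSeqMT3 F n K x ρ S M hM).Om (c.1.1 : ℕ) → c.1.2.tgt ∈ (cubeSeqMT3 F n K x ρ S M hM).Om (c.1.1 : ℕ) →
                  ‖bondAvgIter (c.1.1 : ℕ) (A + Hs (C A)) c.1.2‖ ≤ 6 * ε₁ * (distSite (Mk (F.P K) (c.1.1 : ℕ)) c.1.2.src (iterBlockOf (c.1.1 : ℕ) x) + 1)) ∧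
    (∀ c : BondIdx (cubeSeqMT3 F n K x ρ S M hM),
                  ¬ ((c.1.1 : ℕ) = K - n ∧ c.1.2.src ∈ (cubeSeqMT3 F n K x ρ S M hM).Om (c.1.1 : ℕ) ∧
                      c.1.2.tgt ∈ (cubeSeqMT3 F n K x ρ S M hM).Om (c.1.1 : ℕ)) →
                  ‖bondAvgIter (c.1.1 : ℕ) (A + Hs (C A)) c.1.2‖ ≤ (F.L : ℝ) * (δ + BH * ((64 * (F.L : ℝ) / (16 * 3800 * ((((F.P K).d + 2) * (F.P K).L : ℕ) : ℝ) ^ 2 * (F.L : ℝ))⁻¹) * δ ^ 2)) * (F.L : ℝ) ^ ((K - n) - (c.1.1 : ℕ))) := by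
  intro C
  -- (0) numerics and geometry
  have hL1 : (1 : ℝ) ≤ (F.L : ℝ) := by exact_mod_cast F.hL.2.le
  have hLpos : (0 : ℝ) < (F.L : ℝ) := by linarith
  have hc1 : (1 : ℝ) ≤ ((((F.P K).d + 2) * (F.P K).L : ℕ) : ℝ) := by exact_mod_cast Nat.succ_le_of_lt (Nat.mul_pos (by omega) (F.P K).L_pos)
  have hden : 0 < 16 * 3800 * ((((F.P K).d + 2) * (F.P K).L : ℕ) : ℝ) ^ 2 * (F.L : ℝ) := by positivity
  have hRs0 : 0 < (16 * 3800 * ((((F.P K).d + 2) * (F.P K).L : ℕ) : ℝ) ^ 2 * (F.L : ℝ))⁻¹ := inv_pos.2 hden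
  have hRsle : 16 * 3800 * ((((F.P K).d + 2) * (F.P K).L : ℕ) : ℝ) ^ 2 * (F.L : ℝ) * (16 * 3800 * ((((F.P K).d + 2) * (F.P K).L : ℕ) : ℝ) ^ 2 * (F.L : ℝ))⁻¹ ≤ 1 := (mul_inv_cancel₀ hden.ne').le
  have hC2F0 : 0 ≤ (64 * (F.L : ℝ) / (16 * 3800 * ((((F.P K).d + 2) * (F.P K).L : ℕ) : ℝ) ^ 2 * (F.L : ℝ))⁻¹) := by positivity
  have hη0 : 0 < (((F.L : ℝ)⁻¹) ^ (K - n)) := pow_pos (inv_pos.2 hLpos) _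
  have hηne : (((F.L : ℝ)⁻¹) ^ (K - n)) ≠ 0 := hη0.ne'
  have hw1 : ∀ b, 0 ≤ w 1 b := fun b => levWeight_nonneg hw 1 b
  have hDk : (cubeSeqMT3 F n K x ρ S M hM).k = K - n := cubeSeqMT3_k F n K x ρ S M hM
  have hAdm : Adm22 (cubeSeqMT3 F n K x ρ S M hM) R M := adm22_cubeSeqMT3 F n K x ρ hM hRS
  have hRM1 : 2 * (F.P K).L ≤ R * M + 1 := by
    have : R ≤ R * M := Nat.le_mul_of_pos_right R hM
    omega
  have hcollar := Prop8Chart.collar_of_adm22 (cubeSeqMT3 F n K x ρ S M hM) hAdm hRM1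
  -- (1) B3: the size of `C♭ A`
  have hCA : ∀ c, ‖C A c‖ ≤ (64 * (F.L : ℝ) / (16 * 3800 * ((((F.P K).d + 2) * (F.P K).L : ℕ) : ℝ) ^ 2 * (F.L : ℝ))⁻¹) * δ ^ 2 := fun c =>
    (chartRemainderFlat_hCd_hCq_B1 F n K hRL hM (cubeSeqMT3 F n K x ρ S M hM) hDk hAdm hw).2 A δ hδRs h1 c
  have hCA' : ∀ c, ‖C A c‖ ≤ 4 * (64 * (F.L : ℝ) / (16 * 3800 * ((((F.P K).d + 2) * (F.P K).L : ℕ) : ℝ) ^ 2 * (F.L : ℝ))⁻¹) * ε ^ 2 := fun c => (hCA c).trans htE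
  -- (2) L1: the rows of `A′ = A + Hs (C A)`
  have hAR : ∀ b, w 1 b * ‖A b‖ < (16 * 3800 * ((((F.P K).d + 2) * (F.P K).L : ℕ) : ℝ) ^ 2 * (F.L : ℝ))⁻¹ := fun b => lt_of_le_of_lt (h1 b) (by linarith)
  obtain ⟨hsa', htr', hslice', hsz1, hsz2⟩ := aPrime_rows F n K (cubeSeqMT3 F n K x ρ S M hM) hDk hRL hM hAdm hcollar hw Hs hHs (B₀ := BH)
    (fun X t hX => (hHrows X t hX).1) (fun X t hX => (hHrows X t hX).2) hAsa hAtr hslice (δ := δ) (δ' := δ) (R := (16 * 3800 * ((((F.P K).d + 2) * (F.P K).L : ℕ) : ℝ) ^ 2 * (F.L : ℝ))⁻¹) hδRs h1 h2 hRsle hAR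
  have hA'r₁ : ∀ b, w 1 b * ‖(A + Hs (C A)) b‖ < r₁ := fun b => lt_of_le_of_lt (hsz1 b) hrr₁
  have hA'ε : ∀ b, w 1 b * ‖(A + Hs (C A)) b‖ < ε := fun b => lt_of_lt_of_le (hA'r₁ b) hr₁ε
  have hballε : ∀ X : PBond (F.P K) 0 → Matrix (Fin 2) (Fin 2) ℂ, (∀ b, w 1 b * ‖X b‖ < r₁) → ∀ b, w 1 b * ‖X b‖ < ε := fun X hX b => lt_of_lt_of_le (hX b) hr₁ε
  -- (3) IDENTIFICATION `Dsel A′ = C A` ((49) for the pair `(A′, C A)` is `rfl`; uniqueness on the ε-ball)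
  have h49A : chartLogFlat (((F.L : ℝ)⁻¹) ^ (K - n)) (cubeSeqMT3 F n K x ρ S M hM) ((A + Hs (C A)) - Hs (C A)) - (fderiv ℂ (chartLogFlat (((F.L : ℝ)⁻¹) ^ (K - n)) (cubeSeqMT3 F n K x ρ S M hM) : (PBond (F.P K) 0 → Matrix (Fin 2) (Fin 2) ℂ) → BondIdx (cubeSeqMT3 F n K x ρ S M hM) → Matrix (Fin 2) (Fin 2) ℂ) 0) ((A + Hs (C A)) - Hs (C A)) = C A := by
    rw [add_sub_cancel_right]
    rfl
  have hDA : Dsel (A + Hs (C A)) = C A := ((hE6 _ hA'ε).2.2.2.1 (C A) hCA' h49A).symm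
  have hZA : (A + Hs (C A)) - Hs (Dsel (A + Hs (C A))) = A := by rw [hDA, add_sub_cancel_right]
  -- (4) the (99) correction `E`, by its formula
  obtain ⟨E, hE⟩ : ∃ E : (PBond (F.P K) 0 → Matrix (Fin 2) (Fin 2) ℂ) → (PBond (F.P K) 0 → Matrix (Fin 2) (Fin 2) ℂ),
      ∀ (Y : PBond (F.P K) 0 → Matrix (Fin 2) (Fin 2) ℂ) (b : PBond (F.P K) 0) (i j : Fin 2), E Y b i j = ((((((F.L : ℝ)⁻¹) ^ (K - n)) : ℝ) : ℂ) ^ 4)⁻¹ *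
          (-(((((((F.L : ℝ)⁻¹) ^ (K - n)) : ℝ) : ℂ) ^ 2 / 2) * ∑ p : Plaq (F.P K) 0, Matrix.trace ((Hs (Dsel Y) ⟨p.src, p.μ⟩ + Hs (Dsel Y) ⟨p.src.shift p.μ, p.ν⟩ - Hs (Dsel Y) ⟨p.src.shift p.ν, p.μ⟩ - Hs (Dsel Y) ⟨p.src, p.ν⟩) *
              (((Pi.single b (Matrix.single j i (1 : ℂ)) : PBond (F.P K) 0 → Matrix (Fin 2) (Fin 2) ℂ)) ⟨p.src, p.μ⟩ + ((Pi.single b (Matrix.single j i (1 : ℂ)) : PBond (F.P K) 0 → Matrix (Fin 2) (Fin 2) ℂ)) ⟨p.src.shift p.μ, p.ν⟩ -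
                ((Pi.single b (Matrix.single j i (1 : ℂ)) : PBond (F.P K) 0 → Matrix (Fin 2) (Fin 2) ℂ)) ⟨p.src.shift p.ν, p.μ⟩ - ((Pi.single b (Matrix.single j i (1 : ℂ)) : PBond (F.P K) 0 → Matrix (Fin 2) (Fin 2) ℂ)) ⟨p.src, p.ν⟩)))
            - ((((((F.L : ℝ)⁻¹) ^ (K - n)) : ℝ) : ℂ) ^ 2 / 2) * ∑ p : Plaq (F.P K) 0, Matrix.trace (((Y - Hs (Dsel Y)) ⟨p.src, p.μ⟩ + (Y - Hs (Dsel Y)) ⟨p.src.shift p.μ, p.ν⟩ - (Y - Hs (Dsel Y)) ⟨p.src.shift p.ν, p.μ⟩ - (Y - Hs (Dsel Y)) ⟨p.src, p.ν⟩) *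
              (Hs (fderiv ℂ Dsel Y (Pi.single b (Matrix.single j i (1 : ℂ)))) ⟨p.src, p.μ⟩ + Hs (fderiv ℂ Dsel Y (Pi.single b (Matrix.single j i (1 : ℂ)))) ⟨p.src.shift p.μ, p.ν⟩ -
                Hs (fderiv ℂ Dsel Y (Pi.single b (Matrix.single j i (1 : ℂ)))) ⟨p.src.shift p.ν, p.μ⟩ - Hs (fderiv ℂ Dsel Y (Pi.single b (Matrix.single j i (1 : ℂ)))) ⟨p.src, p.ν⟩))
            - (((((F.L : ℝ)⁻¹) ^ (K - n)) : ℝ) : ℂ) ^ 4 * ∑ b' : PBond (F.P K) 0, Matrix.trace (W₀ (Y - Hs (Dsel Y)) b' * Hs (fderiv ℂ Dsel Y (Pi.single b (Matrix.single j i (1 : ℂ)))) b')) :=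
    ⟨fun Y b => Matrix.of fun i j => ((((((F.L : ℝ)⁻¹) ^ (K - n)) : ℝ) : ℂ) ^ 4)⁻¹ *
          (-(((((((F.L : ℝ)⁻¹) ^ (K - n)) : ℝ) : ℂ) ^ 2 / 2) * ∑ p : Plaq (F.P K) 0, Matrix.trace ((Hs (Dsel Y) ⟨p.src, p.μ⟩ + Hs (Dsel Y) ⟨p.src.shift p.μ, p.ν⟩ - Hs (Dsel Y) ⟨p.src.shift p.ν, p.μ⟩ - Hs (Dsel Y) ⟨p.src, p.ν⟩) *
              (((Pi.single b (Matrix.single j i (1 : ℂ)) : PBond (F.P K) 0 → Matrix (Fin 2) (Fin 2) ℂ)) ⟨p.src, p.μ⟩ + ((Pi.single b (Matrix.single j i (1 : ℂ)) : PBond (F.P K) 0 → Matrix (Fin 2) (Fin 2) ℂ)) ⟨p.src.shift p.μ, p.ν⟩ -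
                ((Pi.single b (Matrix.single j i (1 : ℂ)) : PBond (F.P K) 0 → Matrix (Fin 2) (Fin 2) ℂ)) ⟨p.src.shift p.ν, p.μ⟩ - ((Pi.single b (Matrix.single j i (1 : ℂ)) : PBond (F.P K) 0 → Matrix (Fin 2) (Fin 2) ℂ)) ⟨p.src, p.ν⟩)))
            - ((((((F.L : ℝ)⁻¹) ^ (K - n)) : ℝ) : ℂ) ^ 2 / 2) * ∑ p : Plaq (F.P K) 0, Matrix.trace (((Y - Hs (Dsel Y)) ⟨p.src, p.μ⟩ + (Y - Hs (Dsel Y)) ⟨p.src.shift p.μ, p.ν⟩ - (Y - Hs (Dsel Y)) ⟨p.src.shift p.ν, p.μ⟩ - (Y - Hs (Dsel Y)) ⟨p.src, p.ν⟩) *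
              (Hs (fderiv ℂ Dsel Y (Pi.single b (Matrix.single j i (1 : ℂ)))) ⟨p.src, p.μ⟩ + Hs (fderiv ℂ Dsel Y (Pi.single b (Matrix.single j i (1 : ℂ)))) ⟨p.src.shift p.μ, p.ν⟩ -
                Hs (fderiv ℂ Dsel Y (Pi.single b (Matrix.single j i (1 : ℂ)))) ⟨p.src.shift p.ν, p.μ⟩ - Hs (fderiv ℂ Dsel Y (Pi.single b (Matrix.single j i (1 : ℂ)))) ⟨p.src, p.ν⟩))
            - (((((F.L : ℝ)⁻¹) ^ (K - n)) : ℝ) : ℂ) ^ 4 * ∑ b' : PBond (F.P K) 0, Matrix.trace (W₀ (Y - Hs (Dsel Y)) b' * Hs (fderiv ℂ Dsel Y (Pi.single b (Matrix.single j i (1 : ℂ)))) b')), fun _ _ _ _ => rfl⟩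
  -- (5) differentiability of the chart action and the curl-form gradient identity for FILE E's `W₀`
  obtain ⟨Wg, hg1, -, -, hSd, hg5⟩ := FlatActionGradient.exists_gradient_action_T3 F n K
  have hgrad : ∀ A δ : PBond (F.P K) 0 → Matrix (Fin 2) (Fin 2) ℂ, fderiv ℂ (fun A : PBond (F.P K) 0 → Matrix (Fin 2) (Fin 2) ℂ => (∑ p : Plaq (F.P K) 0, (1 - (2 : ℂ)⁻¹ * Matrix.trace (exp ((Complex.I * ((((F.L : ℝ)⁻¹) ^ (K - n) : ℝ) : ℂ)) • A ⟨p.src, p.μ⟩) * exp ((Complex.I * ((((F.L : ℝ)⁻¹) ^ (K - n) : ℝ) : ℂ)) • A ⟨p.src.shift p.μ, p.ν⟩) * exp (-((Complex.I * ((((F.L : ℝ)⁻¹) ^ (K - n) : ℝ) : ℂ)) • A ⟨p.src.shift p.ν, p.μ⟩)) * exp (-((Complex.I * ((((F.L : ℝ)⁻¹) ^ (K - n) : ℝ) : ℂ)) • A ⟨p.src, p.ν⟩)))))) A δ =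
      (((((F.L : ℝ)⁻¹) ^ (K - n) : ℝ) : ℂ) ^ 2 / 2) * ∑ p : Plaq (F.P K) 0, Matrix.trace ((A ⟨p.src, p.μ⟩ + A ⟨p.src.shift p.μ, p.ν⟩ - A ⟨p.src.shift p.ν, p.μ⟩ - A ⟨p.src, p.ν⟩) * (δ ⟨p.src, p.μ⟩ + δ ⟨p.src.shift p.μ, p.ν⟩ - δ ⟨p.src.shift p.ν, p.μ⟩ - δ ⟨p.src, p.ν⟩)) + ((((F.L : ℝ)⁻¹) ^ (K - n) : ℝ) : ℂ) ^ 4 * ∑ b : PBond (F.P K) 0, Matrix.trace (W₀ A b * δ b) :=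
    fun A δ => by rw [hg5 A δ, ← hg1 A δ, hE11 A δ]
  -- (6) L2′: the trace pairing at `A′` through the local competitor map
  have hball : ∀ X : PBond (F.P K) 0 → Matrix (Fin 2) (Fin 2) ℂ, (∀ b, w 1 b * ‖X b‖ < r₁) → ∀ b, w 1 b * ‖(X - Hs (Dsel X)) b‖ < (16 * 3800 * ((((F.P K).d + 2) * (F.P K).L : ℕ) : ℝ) ^ 2 * (F.L : ℝ))⁻¹ := by
    intro X hX b
    have hsz := (hE6 X (hballε X hX)).1
    have hrow := (hHrows (Dsel X) _ hsz).1 b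
    have hsub : ‖(X - Hs (Dsel X)) b‖ ≤ ‖X b‖ + ‖Hs (Dsel X) b‖ := by rw [Pi.sub_apply]; exact norm_sub_le _ _
    have h3 : w 1 b * ‖(X - Hs (Dsel X)) b‖ ≤ w 1 b * ‖X b‖ + w 1 b * ‖Hs (Dsel X) b‖ := by nlinarith [hw1 b]
    linarith [hX b]
  have hchartNear' : ∀ b, Near b → ((GaugeField.gaugeAct uS Umin b : Matrix.specialUnitaryGroup (Fin 2) ℂ) : Matrix (Fin 2) (Fin 2) ℂ) =
      exp ((Complex.I * ((((F.L : ℝ)⁻¹) ^ (K - n) : ℝ) : ℂ)) • ((A + Hs (C A)) - Hs (Dsel (A + Hs (C A)))) b) := fun b hb => by rw [hZA]; exact hchartNear b hb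
  have hpair := hpair_of_hcrit_local F n K (cubeSeqMT3 F n K x ρ S M hM) hDk hcollar hw hRsle (((F.L : ℝ)⁻¹) ^ (K - n)) hηne W₀ hSd hgrad Hs hHs Dsel E hE (r₁ := r₁) (t := 4 * (64 * (F.L : ℝ) / (16 * 3800 * ((((F.P K).d + 2) * (F.P K).L : ℕ) : ℝ) ^ 2 * (F.L : ℝ))⁻¹) * ε ^ 2)
    (fun X hX => (hE6 X (hballε X hX)).2.1) (fun X hX => (hE6 X (hballε X hX)).1) (fun X hX => (hE6 X (hballε X hX)).2.2.2.1)
    (fun X hX => (hE4 X (hballε X hX)).differentiableAt) hball Uc hUc hsa' htr' hA'r₁ hnK.le ε₀ V hcrit hHinv Near Tch hTN hTF uS hchartNear' hΦ1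
  -- (7) the member's (165) implication
  have hr0 : 0 ≤ δ + BH * ((64 * (F.L : ℝ) / (16 * 3800 * ((((F.P K).d + 2) * (F.P K).L : ℕ) : ℝ) ^ 2 * (F.L : ℝ))⁻¹) * δ ^ 2) := by positivity
  have h4 : 0 ≤ 4 * C₄ * (δ + BH * ((64 * (F.L : ℝ) / (16 * 3800 * ((((F.P K).d + 2) * (F.P K).L : ℕ) : ℝ) ^ 2 * (F.L : ℝ))⁻¹) * δ ^ 2)) ^ 2 := by positivity
  have hnum1 : B₀r * (4 * C₄ * (δ + BH * ((64 * (F.L : ℝ) / (16 * 3800 * ((((F.P K).d + 2) * (F.P K).L : ℕ) : ℝ) ^ 2 * (F.L : ℝ))⁻¹) * δ ^ 2)) ^ 2) ≤ max B₀r (1 + BM) * (4 * C₄ * (δ + BH * ((64 * (F.L : ℝ) / (16 * 3800 * ((((F.P K).d + 2) * (F.P K).L : ℕ) : ℝ) ^ 2 * (F.L : ℝ))⁻¹) * δ ^ 2)) ^ 2) :=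
    mul_le_mul_of_nonneg_right (le_max_left _ _) h4
  have hnum2 : (1 + BM) * (4 * C₄ * (δ + BH * ((64 * (F.L : ℝ) / (16 * 3800 * ((((F.P K).d + 2) * (F.P K).L : ℕ) : ℝ) ^ 2 * (F.L : ℝ))⁻¹) * δ ^ 2)) ^ 2) ≤ max B₀r (1 + BM) * (4 * C₄ * (δ + BH * ((64 * (F.L : ℝ) / (16 * 3800 * ((((F.P K).d + 2) * (F.P K).L : ℕ) : ℝ) ^ 2 * (F.L : ℝ))⁻¹) * δ ^ 2)) ^ 2) :=
    mul_le_mul_of_nonneg_right (le_max_right _ _) h4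
  have h165rows := h165 (A + Hs (C A)) hsa' htr' (fun Y => W₀ (Y - Hs (Dsel Y)) + E Y) (C₄ := C₄) (a₃ := a₃) (r := δ + BH * ((64 * (F.L : ℝ) / (16 * 3800 * ((((F.P K).d + 2) * (F.P K).L : ℕ) : ℝ) ^ 2 * (F.L : ℝ))⁻¹) * δ ^ 2))
    (e := max B₀r (1 + BM) * (4 * C₄ * (δ + BH * ((64 * (F.L : ℝ) / (16 * 3800 * ((((F.P K).d + 2) * (F.P K).L : ℕ) : ℝ) ^ 2 * (F.L : ℝ))⁻¹) * δ ^ 2)) ^ 2))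
    (fun Y r' hr' hY1 hY2 => hE13 E hE Y r' hr' hY1 hY2) hpair hslice' hra₃ hsz1 hsz2 hnum1 hnum2
  -- (8) (157): the `R` rows of `Hs (C A)`
  have h157 := rRows_scaled_of_uniformDatum hnK x ρ S M hM hρ1 hw hH h162 hdom hδ₀ hB₀ hB₃ (t := (64 * (F.L : ℝ) / (16 * 3800 * ((((F.P K).d + 2) * (F.P K).L : ℕ) : ℝ) ^ 2 * (F.L : ℝ))⁻¹) * δ ^ 2) (by positivity)
    (⇑Hs) (fun X b => hHs X b) hCA
  -- (9) (160) near: the top datum of `A′` IS `Q♭(A)`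
  have hHinvR : ∀ (X : BondIdx (cubeSeqMT3 F n K x ρ S M hM) → Matrix (Fin 2) (Fin 2) ℂ) (c : BondIdx (cubeSeqMT3 F n K x ρ S M hM)),
      ((F.L : ℝ) ^ (c.1.1 : ℕ) * ((F.L : ℝ)⁻¹) ^ (K - n)) • bondAvgIter (c.1.1 : ℕ) (Hs X) c.1.2 = X c := by
    intro X c
    have h := congr_fun (hHinv X) c
    rw [fderiv_chartLogFlat_zero_apply] at h
    rw [RCLike.real_smul_eq_coe_smul (K := ℂ), ← h]
    congr 1
    push_cast
    rw [show (((F.P K).L : ℕ) : ℂ) = ((F.L : ℕ) : ℂ) from rfl]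
    ring
  have hnear : ∀ c : BondIdx (cubeSeqMT3 F n K x ρ S M hM), (c.1.1 : ℕ) = K - n → c.1.2.src ∈ (cubeSeqMT3 F n K x ρ S M hM).Om (c.1.1 : ℕ) → c.1.2.tgt ∈ (cubeSeqMT3 F n K x ρ S M hM).Om (c.1.1 : ℕ) →
      ‖bondAvgIter (c.1.1 : ℕ) (A + Hs (C A)) c.1.2‖ ≤ 6 * ε₁ * (distSite (Mk (F.P K) (c.1.1 : ℕ)) c.1.2.src (iterBlockOf (c.1.1 : ℕ) x) + 1) := by
    intro c hc hs ht
    have hscal : ((((F.L : ℝ)⁻¹) ^ (K - n) : ℝ) : ℂ) * (((F.P K).L : ℕ) : ℂ) ^ (c.1.1 : ℕ) = 1 := by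
      rw [hc, show (((F.P K).L : ℕ) : ℂ) = ((F.L : ℕ) : ℂ) from rfl]
      push_cast
      rw [inv_pow, inv_mul_cancel₀ (pow_ne_zero _ (by exact_mod_cast (show (F.L : ℝ) ≠ 0 from hLpos.ne')))]
    have hCc : C A c = chartLogFlat (((F.L : ℝ)⁻¹) ^ (K - n)) (cubeSeqMT3 F n K x ρ S M hM) A c - bondAvgIter (c.1.1 : ℕ) A c.1.2 := by
      show chartLogFlat (((F.L : ℝ)⁻¹) ^ (K - n)) (cubeSeqMT3 F n K x ρ S M hM) A c - (fderiv ℂ (chartLogFlat (((F.L : ℝ)⁻¹) ^ (K - n)) (cubeSeqMT3 F n K x ρ S M hM) : (PBond (F.P K) 0 → Matrix (Fin 2) (Fin 2) ℂ) → BondIdx (cubeSeqMT3 F n K x ρ S M hM) → Matrix (Fin 2) (Fin 2) ℂ) 0) A c = _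
      rw [fderiv_chartLogFlat_zero_apply, hscal, one_smul]
    rw [bondAvgIter_top_chartPreimage (cubeSeqMT3 F n K x ρ S M hM) (⇑Hs) hHinvR A (C A) c hc, hCc, add_sub_cancel]
    exact hvi c hc hs ht
  -- (10) (155) far
  have hfar : ∀ c : BondIdx (cubeSeqMT3 F n K x ρ S M hM), ¬ ((c.1.1 : ℕ) = K - n ∧ c.1.2.src ∈ (cubeSeqMT3 F n K x ρ S M hM).Om (c.1.1 : ℕ) ∧ c.1.2.tgt ∈ (cubeSeqMT3 F n K x ρ S M hM).Om (c.1.1 : ℕ)) →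
      ‖bondAvgIter (c.1.1 : ℕ) (A + Hs (C A)) c.1.2‖ ≤ (F.L : ℝ) * (δ + BH * ((64 * (F.L : ℝ) / (16 * 3800 * ((((F.P K).d + 2) * (F.P K).L : ℕ) : ℝ) ^ 2 * (F.L : ℝ))⁻¹) * δ ^ 2)) * (F.L : ℝ) ^ ((K - n) - (c.1.1 : ℕ)) :=
    fun c _ => far_bondAvgIter x ρ S M hM hRS hRM hw (A' := A + Hs (C A)) hsz1 c
  exact ⟨h165rows, h157, hnear, hfar⟩

end Summit.QuantumFields.YangMills.Theorems.HalvingSitePackage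

end
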